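import Summits.Ventures.PercRepro.SevenThreeP1Final
import Summits.Ventures.PercRepro.SevenThreeSmallPlanes

/-!
# PercRepro — the `(7,3)` cell: THE (7,3) CORE THEOREM (p3, gen 16)

`Core M 7 → ThmN.RLS M 7 3`: Theorem P₁(7,3) and the bridge (`rls_seven_three_of_positive_planes`,
`SevenThreeP1Final.lean`) with night-3's per-plane inequality on the positive-type planes of a core matroid
(`perPlane_positive_of_core`, `SevenThreeSmallPlanes.lean`) — the sole remaining hypothesis of night-3's
`c025_three_of_seven` (the q = 3 row of C-025 on every finite matroid, every p ≥ 5).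
-/

namespace PercRepro

namespace SevenThree

open Finset ThmH SixThree PerFlat

/-- **THE `(7,3)` CORE THEOREM**: every core matroid of rank `7` satisfies `ThmN.RLS M 7 3` — `hc.1` is `Simple M`
and `hc.2.1` is `M.eRank = 7` by unfolding `NightThree.Core`. -/
theorem rls_seven_three_of_core {α : Type} [DecidableEq α] {M : Matroid α} [M.Finite] (hc : NightThree.Core M 7) :
    ThmN.RLS M 7 3 :=
  rls_seven_three_of_positive_planes hc.1 hc.2.1 (fun _ hG hlt => perPlane_positive_of_core hc hG hlt)

end SevenThree

end PercRepro
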